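import Summits.HodgeConjecture.CorCM.PairFlipCompanionCMFieldsHodge
import Summits.HodgeConjecture.CorCM.PairFlipIsomorphicFieldsFamilies
import HarnessLib

/-!
# A generic CM field is Hodge-independent of every other CM field over the same totally real field

COR-CM (cell `pub-hodgecm2`, binder seat `b16` gen 51, count-neutral claim PAIRFLIP-COMPANION, file F3 — CM fields and
abelian varieties; theorems only, no definition, no named fact, no `sorry`).  NEW as stated, hence under `Summits/`.
HONEST FRAMING: unconditional theorems on pairs of CM abelian varieties; `HC_CM` is neither used nor asserted.

SETTING.  A totally real number field `F`, two CM fields `K_{i₀} ⊇ e₀(F)`, `K_{i₁} ⊇ e₁(F)` with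
`[K_{i₀} : ℚ] = [K_{i₁} : ℚ] = 2[F : ℚ]` — two totally imaginary quadratic extensions `F(√−α)`, `F(√−β)` of ONE totally
real field — where `K_{i₀}` has PAIR FLIPS (its Galois closure contains the full sign group `(ℤ/2)ⁿ`: the generic case).
NOTHING is assumed on `K_{i₁}` beyond being CM over `F`: its Galois closure, its sign group, its imaginary quadratic
subfields are arbitrary.  By F2 (`pairFlip_compatible_of_ringHom_real`) the pair flips of `K_{i₀}` preserve the
conjugate pairs of `K_{i₁}`, so (`isNondegenerateFamily_iff_of_pairFlip_compatible`):

* §1 **`isNondegenerateFamily_iff_of_pairFlip_of_ringHom_real`** — if `K_{i₀} ≇ K_{i₁}`: the two-slot family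
  `(Φ_{i₀}, Φ_{i₁})` is nondegenerate ⟺ `Φ_{i₁}` is nondegenerate (`Hg(A₀ × A₁) = Hg(A₀) × Hg(A₁)`, rank additivity
  `cmFamilyRank_add_card_eq_of_pairFlip_of_ringHom_real` for ALL types); the special case `F = K_{i₁}⁺` embedded in
  `K_{i₀}` (`…_of_maximalRealSubfield`).
* §2 on abelian varieties, WITHOUT the hypothesis `K_{i₀} ≇ K_{i₁}` (the isomorphic case is seat p2's / b16 gen 43's
  `PairFlipIsomorphicFieldsFamilies`): for SIMPLE, non-isogenous realisations
  **`isNondegenerateFamily_iff_of_pairFlip_of_ringHom_real_of_not_isIsogenous`** (nondegenerate family ⟺ `Φ_{i₁}` nondegenerate),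
  **`forall_prod_hodgeClassSpan_eq_iff_of_pairFlip_of_ringHom_real`** (`B• = D•` on ALL `A₀^a × A₁^b` ⟺ `Φ_{i₁}`
  nondegenerate ⟺ no power of `A₁` ALONE carries an exceptional class: the generic partner `A₀` never creates new
  exceptional Hodge classes), and **`hodgeConjectureFor_prod_of_pairFlip_of_ringHom_real`** — the Hodge conjecture with
  `B• = D•` on every `A₀^a × A₁^b` when `Φ_{i₁}` is nondegenerate, UNCONDITIONALLY.

EXAMPLES (not formalised here).  For a generic `K = F(√−α)` of degree `2n` (`α ∈ F` totally positive, closure of degree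
`2ⁿ·[F̃:ℚ]`) every `K' = F(√−β)` qualifies: the companions `F(√−qα)` (`q ∈ ℚ_{>0}`), `F(√−α·disc)`… inside or outside
the Galois closure of `K`, the fields `F·k` (`k` imaginary quadratic, where `Φ'` may be degenerate and then `A × A'`
does carry exceptional classes — exactly those of the powers of `A'`).  Degree `6` is the tree's
`PairFlipSameClosurePairwise` + `GenericSexticThreefoldTimesCMHodge`; degree `8` is the `(4,4)` cell of the sequel
`PairFlipCompanionFourfolds`.

## References

* [Dodson1984] B. Dodson, *The structure of Galois groups of CM-fields*, Trans. AMS 283 (1984), §1.1, §5.1.2.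
* [Gordon1999HodgeAVSurvey] B. B. Gordon, *A survey of the Hodge conjecture for abelian varieties*, §3 Theorem, 7.4–7.7,
  10.10.
* [Shimura1998] G. Shimura, *Abelian Varieties with Complex Multiplication and Modular Functions*, §5.2 Thm. 1, §18.2.
-/

noncomputable section

open CategoryTheory CategoryTheory.Limits NumberField Module IntermediateField

namespace Summit.HodgeConjecture.CorCM

open Literature.NumberTheory.ComplexMultiplication
open Literature.AlgebraicGeometry.Motives (AbelianVariety CMType)
open Literature.AlgebraicGeometry.HodgeTheory
open Literature.AlgebraicGeometry.ComplexMultiplication (IsCMTypeRealisation isSimple_iff_isPrimitive)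
open Literature.AlgebraicGeometry.VanGeemen1994 (hodgeClassSpan)
open Literature.AlgebraicGeometry.Pohlmann1968
open Literature.Barriers.HodgeConjecture (divisorClassesSpan)

variable {I : Type} {K : I → Type} [∀ i, Field (K i)] [∀ i, NumberField (K i)] [∀ i, IsCMField (K i)] [Fintype I]
  [DecidableEq I] [Nonempty I] {Φ : ∀ i, CMType (K i)}
  {F : Type} [Field F] [NumberField F] [IsTotallyReal F]

/-! ## §1 Types: non-isomorphic fields over one totally real field -/

section Types

/-- **Over one totally real field, a generic CM field pairs additively with every non-isomorphic CM field: the family is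
nondegenerate iff the partner type is.**  `K_{i₀}` with pair flips, `e₀ : F → K_{i₀}`, `e₁ : F → K_{i₁}`, `F` totally real
with `[K_{i₀}:ℚ] = [K_{i₁}:ℚ] = 2[F:ℚ]`, `K_{i₀} ≇ K_{i₁}`, `I = {i₀, i₁}`.
[cite: Gordon1999HodgeAVSurvey, §3 Theorem and 7.5–7.7] [cite: Dodson1984, §1.1 and §5.1.2] -/
theorem isNondegenerateFamily_iff_of_pairFlip_of_ringHom_real {i₀ i₁ : I} (hI : ∀ j, j = i₀ ∨ j = i₁)
    (hflip : ∀ s : K i₀ →+* ℂ, ∃ σ : ℂ ≃+* ℂ, σ • s = (starRingAut : ℂ ≃+* ℂ) • s ∧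
      ∀ t : K i₀ →+* ℂ, t ≠ s → t ≠ (starRingAut : ℂ ≃+* ℂ) • s → σ • t = t)
    (e₀ : F →+* K i₀) (e₁ : F →+* K i₁) (hF₀ : finrank ℚ (K i₀) = 2 * finrank ℚ F)
    (hF₁ : finrank ℚ (K i₁) = 2 * finrank ℚ F) (hne : IsEmpty (K i₀ ≃+* K i₁)) :
    CMAlgebra.IsNondegenerateFamily Φ ↔ IsNondegenerate (Φ i₁) :=
  isNondegenerateFamily_iff_of_pairFlip_compatible hI (pairFlip_compatible_of_ringHom_real (Φ i₀) hflip e₀ e₁ hF₁)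
    (hF₀.trans hF₁.symm) hne

/-- **Rank additivity** `Hg(A₀ × A₁) = Hg(A₀) × Hg(A₁)` for a generic CM field against any non-isomorphic CM field over
the same totally real field, for ALL types. [cite: Gordon1999HodgeAVSurvey, §3 Theorem (1)] -/
theorem cmFamilyRank_add_card_eq_of_pairFlip_of_ringHom_real {i₀ i₁ : I} (hI : ∀ j, j = i₀ ∨ j = i₁)
    (hflip : ∀ s : K i₀ →+* ℂ, ∃ σ : ℂ ≃+* ℂ, σ • s = (starRingAut : ℂ ≃+* ℂ) • s ∧
      ∀ t : K i₀ →+* ℂ, t ≠ s → t ≠ (starRingAut : ℂ ≃+* ℂ) • s → σ • t = t)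
    (e₀ : F →+* K i₀) (e₁ : F →+* K i₁) (hF₀ : finrank ℚ (K i₀) = 2 * finrank ℚ F)
    (hF₁ : finrank ℚ (K i₁) = 2 * finrank ℚ F) (hne : IsEmpty (K i₀ ≃+* K i₁)) :
    CMAlgebra.cmFamilyRank Φ + Fintype.card I = (∑ i, cmTypeRank (Φ i)) + 1 :=
  cmFamilyRank_add_card_eq_of_pairFlip_compatible hI (pairFlip_compatible_of_ringHom_real (Φ i₀) hflip e₀ e₁ hF₁)
    (hF₀.trans hF₁.symm) hne

omit [Fintype I] [DecidableEq I] [Nonempty I] in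
/-- `[K : ℚ] = 2 [K⁺ : ℚ]` for a CM field. [cite: Shimura1998, §5.2 Thm. 1 (CM1)] -/
theorem finrank_eq_two_mul_finrank_maximalRealSubfield (i : I) :
    finrank ℚ (K i) = 2 * finrank ℚ (maximalRealSubfield (K i)) := by
  rw [← Module.finrank_mul_finrank ℚ (maximalRealSubfield (K i)) (K i),
    Algebra.IsQuadraticExtension.finrank_eq_two (maximalRealSubfield (K i)) (K i), mul_comm]

/-- **The maximal-real-subfield form**: `K_{i₀}` with pair flips, `K_{i₁}⁺` embedded in `K_{i₀}`, equal degrees,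
`K_{i₀} ≇ K_{i₁}`: nondegenerate family ⟺ `Φ_{i₁}` nondegenerate. [cite: Gordon1999HodgeAVSurvey, §3 Theorem and 7.5–7.7]
[cite: Shimura1998, §5.2 Thm. 1] -/
theorem isNondegenerateFamily_iff_of_pairFlip_of_maximalRealSubfield {i₀ i₁ : I} (hI : ∀ j, j = i₀ ∨ j = i₁)
    (hflip : ∀ s : K i₀ →+* ℂ, ∃ σ : ℂ ≃+* ℂ, σ • s = (starRingAut : ℂ ≃+* ℂ) • s ∧
      ∀ t : K i₀ →+* ℂ, t ≠ s → t ≠ (starRingAut : ℂ ≃+* ℂ) • s → σ • t = t)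
    (e : maximalRealSubfield (K i₁) →+* K i₀) (hdeg : finrank ℚ (K i₀) = finrank ℚ (K i₁))
    (hne : IsEmpty (K i₀ ≃+* K i₁)) : CMAlgebra.IsNondegenerateFamily Φ ↔ IsNondegenerate (Φ i₁) :=
  isNondegenerateFamily_iff_of_pairFlip_of_ringHom_real hI hflip e (maximalRealSubfield (K i₁)).subtype
    (hdeg.trans (finrank_eq_two_mul_finrank_maximalRealSubfield i₁)) (finrank_eq_two_mul_finrank_maximalRealSubfield i₁)
    hne

end Types

/-! ## §2 Abelian varieties: the isomorphic case absorbed -/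

section Geometry

variable {A : I → AbelianVariety ℂ} {ι : ∀ i, 𝓞 (K i) →+* End (A i)}
  {θ : ∀ i, K i →+* Module.End ℂ (complexBetti (A i).X 1)}

omit [∀ i, IsCMField (K i)] [DecidableEq I] [Nonempty I] in
/-- A two-point index type has at most three elements. [folklore] -/
private theorem card_le_three_of_forall_eq_or {i₀ i₁ : I} (hI : ∀ j, j = i₀ ∨ j = i₁) : Fintype.card I ≤ 3 := by
  classical
  calc Fintype.card I = (Finset.univ : Finset I).card := Finset.card_univ.symm
    _ ≤ ({i₀, i₁} : Finset I).card := Finset.card_le_card fun j _ => by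
        rcases hI j with rfl | rfl
        · exact Finset.mem_insert_self _ _
        · exact Finset.mem_insert_of_mem (Finset.mem_singleton_self _)
    _ ≤ 2 := Finset.card_le_two
    _ ≤ 3 := by norm_num

/-- **Simple non-isogenous realisations: the family is nondegenerate iff the partner type is — whether or not the fields
are isomorphic.**  `K_{i₀}` with pair flips, `A_{i₀}`, `A_{i₁}` simple non-isogenous realisations of types of CM fields over
one totally real `F` of half their degree.  If `K_{i₀} ≅ K_{i₁}` both are pair-flip fields and two non-isogenous members are
independent (`PairFlipIsomorphicFieldsFamilies`); otherwise §1. [cite: Gordon1999HodgeAVSurvey, §3 Theorem, 7.4–7.7]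
[cite: Dodson1984, §5.1.2] -/
theorem isNondegenerateFamily_iff_of_pairFlip_of_ringHom_real_of_not_isIsogenous {i₀ i₁ : I} (hI : ∀ j, j = i₀ ∨ j = i₁)
    (hflip : ∀ s : K i₀ →+* ℂ, ∃ σ : ℂ ≃+* ℂ, σ • s = (starRingAut : ℂ ≃+* ℂ) • s ∧
      ∀ t : K i₀ →+* ℂ, t ≠ s → t ≠ (starRingAut : ℂ ≃+* ℂ) • s → σ • t = t)
    (e₀ : F →+* K i₀) (e₁ : F →+* K i₁) (hF₀ : finrank ℚ (K i₀) = 2 * finrank ℚ F)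
    (hF₁ : finrank ℚ (K i₁) = 2 * finrank ℚ F) (hA : ∀ i, IsCMTypeRealisation (Φ i) (A i) (ι i) (θ i))
    (hniso : ∀ i j, i ≠ j → ¬ AbelianVariety.IsIsogenous (A i) (A j)) :
    CMAlgebra.IsNondegenerateFamily Φ ↔ IsNondegenerate (Φ i₁) := by
  by_cases hK : Nonempty (K i₀ ≃+* K i₁)
  · -- isomorphic fields: transport to one pair-flip field; two non-isogenous members are independent
    obtain ⟨e⟩ := hK
    have e' : ∀ j, K j ≃+* K i₀ := by
      intro j
      by_cases hj : j = i₀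
      · subst hj; exact RingEquiv.refl _
      · have hj1 : j = i₁ := (hI j).resolve_left hj
        subst hj1; exact e.symm
    have hnd : CMAlgebra.IsNondegenerateFamily Φ :=
      isNondegenerateFamily_of_ringEquiv_of_pairFlip_of_card_le_three e' hflip hA hniso
        (card_le_three_of_forall_eq_or hI)
    exact ⟨fun h => h.isNondegenerate i₁, fun _ => hnd⟩
  · rw [not_nonempty_iff] at hK
    exact isNondegenerateFamily_iff_of_pairFlip_of_ringHom_real hI hflip e₀ e₁ hF₀ hF₁ hK

/-- **`B• = D•` on ALL `A₀^a × A₁^b` iff the partner type is nondegenerate** — iff no power of `A₁` alone carries an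
exceptional Hodge class: a generic CM abelian variety `A₀` never creates exceptional classes with a partner over the same
totally real field.  Simple, non-isogenous realisations; no hypothesis on the closure of `K_{i₁}`.
[cite: Gordon1999HodgeAVSurvey, 7.5 (1) ⟺ (3) and 7.6.1] -/
theorem forall_prod_hodgeClassSpan_eq_iff_of_pairFlip_of_ringHom_real {i₀ i₁ : I} (hI : ∀ j, j = i₀ ∨ j = i₁)
    (hflip : ∀ s : K i₀ →+* ℂ, ∃ σ : ℂ ≃+* ℂ, σ • s = (starRingAut : ℂ ≃+* ℂ) • s ∧
      ∀ t : K i₀ →+* ℂ, t ≠ s → t ≠ (starRingAut : ℂ ≃+* ℂ) • s → σ • t = t)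
    (e₀ : F →+* K i₀) (e₁ : F →+* K i₁) (hF₀ : finrank ℚ (K i₀) = 2 * finrank ℚ F)
    (hF₁ : finrank ℚ (K i₁) = 2 * finrank ℚ F) (hA : ∀ i, IsCMTypeRealisation (Φ i) (A i) (ι i) (θ i))
    (hS : ∀ i, (A i).IsSimple) (hniso : ∀ i j, i ≠ j → ¬ AbelianVariety.IsIsogenous (A i) (A j)) :
    (∀ (N : ℕ) (π : Fin N → I) (m : ℕ),
      hodgeClassSpan (⨁ fun j : Fin N => A (π j)).dim (⨁ fun j : Fin N => A (π j)).X m =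
        divisorClassesSpan (⨁ fun j : Fin N => A (π j)).X (⨁ fun j : Fin N => A (π j)).dim m) ↔
      IsNondegenerate (Φ i₁) := by
  have hiff := isNondegenerateFamily_iff_of_pairFlip_of_ringHom_real_of_not_isIsogenous hI hflip e₀ e₁ hF₀ hF₁ hA hniso
  constructor
  · intro h
    by_contra hdegn
    have hfam : ¬ CMAlgebra.IsNondegenerateFamily Φ := fun hf => hdegn (hiff.1 hf)
    obtain ⟨N, π, m, c, hcQ, hcH, hcD⟩ := CMAlgebra.exists_exceptional_prod_of_not_isNondegenerateFamily
      (CMAlgebra.isSeparatingFamily_of_isSimple_of_pairwise_not_isIsogenous hA hS hniso) hfam hA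
    exact hcD (by rw [← h N π m]; exact Submodule.subset_span ⟨hcQ, hcH⟩)
  · intro hnd N π m
    exact (hiff.2 hnd).hodgeClassSpan_prod_eq_divisorClassesSpan hA π m

/-- **The Hodge conjecture on every `A₀^a × A₁^b`**, with `B• = D•` there, for SIMPLE non-isogenous realisations of a
type of a pair-flip CM field and of a NONDEGENERATE type of any CM field over the same totally real field of half the
degree — UNCONDITIONALLY; no hypothesis on the Galois closure of the partner.
[cite: Gordon1999HodgeAVSurvey, §3 Theorem, 7.5 and 10.10] -/
theorem hodgeConjectureFor_prod_of_pairFlip_of_ringHom_real {i₀ i₁ : I} (hI : ∀ j, j = i₀ ∨ j = i₁)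
    (hflip : ∀ s : K i₀ →+* ℂ, ∃ σ : ℂ ≃+* ℂ, σ • s = (starRingAut : ℂ ≃+* ℂ) • s ∧
      ∀ t : K i₀ →+* ℂ, t ≠ s → t ≠ (starRingAut : ℂ ≃+* ℂ) • s → σ • t = t)
    (e₀ : F →+* K i₀) (e₁ : F →+* K i₁) (hF₀ : finrank ℚ (K i₀) = 2 * finrank ℚ F)
    (hF₁ : finrank ℚ (K i₁) = 2 * finrank ℚ F) (hA : ∀ i, IsCMTypeRealisation (Φ i) (A i) (ι i) (θ i))
    (hniso : ∀ i j, i ≠ j → ¬ AbelianVariety.IsIsogenous (A i) (A j)) (hnd : IsNondegenerate (Φ i₁))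
    {N : ℕ} (π : Fin N → I) :
    HodgeConjectureFor (⨁ fun j : Fin N => A (π j)).dim (⨁ fun j : Fin N => A (π j)).X ∧
      ∀ m : ℕ, hodgeClassSpan (⨁ fun j : Fin N => A (π j)).dim (⨁ fun j : Fin N => A (π j)).X m =
        divisorClassesSpan (⨁ fun j : Fin N => A (π j)).X (⨁ fun j : Fin N => A (π j)).dim m :=
  have h := (isNondegenerateFamily_iff_of_pairFlip_of_ringHom_real_of_not_isIsogenous hI hflip e₀ e₁ hF₀ hF₁ hA hniso).2 hnd
  ⟨h.hodgeConjectureFor_prod hA π, fun m => h.hodgeClassSpan_prod_eq_divisorClassesSpan hA π m⟩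

/-- **Without simplicity, for non-isomorphic fields**: the Hodge conjecture with `B• = D•` on every `A₀^a × A₁^b` for
realisations of any type of the pair-flip field `K_{i₀}` and a nondegenerate type of `K_{i₁} ≇ K_{i₀}` over the same
totally real field of half the degree. [cite: Gordon1999HodgeAVSurvey, 7.5 and 10.10] -/
theorem hodgeConjectureFor_prod_of_pairFlip_of_ringHom_real_of_isEmpty {i₀ i₁ : I} (hI : ∀ j, j = i₀ ∨ j = i₁)
    (hflip : ∀ s : K i₀ →+* ℂ, ∃ σ : ℂ ≃+* ℂ, σ • s = (starRingAut : ℂ ≃+* ℂ) • s ∧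
      ∀ t : K i₀ →+* ℂ, t ≠ s → t ≠ (starRingAut : ℂ ≃+* ℂ) • s → σ • t = t)
    (e₀ : F →+* K i₀) (e₁ : F →+* K i₁) (hF₀ : finrank ℚ (K i₀) = 2 * finrank ℚ F)
    (hF₁ : finrank ℚ (K i₁) = 2 * finrank ℚ F) (hne : IsEmpty (K i₀ ≃+* K i₁)) (hnd : IsNondegenerate (Φ i₁))
    (hA : ∀ i, IsCMTypeRealisation (Φ i) (A i) (ι i) (θ i)) {N : ℕ} (π : Fin N → I) :
    HodgeConjectureFor (⨁ fun j : Fin N => A (π j)).dim (⨁ fun j : Fin N => A (π j)).X ∧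
      ∀ m : ℕ, hodgeClassSpan (⨁ fun j : Fin N => A (π j)).dim (⨁ fun j : Fin N => A (π j)).X m =
        divisorClassesSpan (⨁ fun j : Fin N => A (π j)).X (⨁ fun j : Fin N => A (π j)).dim m :=
  have h := (isNondegenerateFamily_iff_of_pairFlip_of_ringHom_real hI hflip e₀ e₁ hF₀ hF₁ hne).2 hnd
  ⟨h.hodgeConjectureFor_prod hA π, fun m => h.hodgeClassSpan_prod_eq_divisorClassesSpan hA π m⟩

/-- **Exceptional classes**: for simple non-isogenous realisations as above, SOME `A₀^a × A₁^b` carries an exceptional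
Hodge class (a rational `(m,m)`-class outside `Dᵐ ⊗ ℂ`) iff `Φ_{i₁}` is degenerate — the classes then come from `A₁`.
[cite: Gordon1999HodgeAVSurvey, 7.5 and 7.6.1] -/
theorem exists_exceptional_prod_iff_of_pairFlip_of_ringHom_real {i₀ i₁ : I} (hI : ∀ j, j = i₀ ∨ j = i₁)
    (hflip : ∀ s : K i₀ →+* ℂ, ∃ σ : ℂ ≃+* ℂ, σ • s = (starRingAut : ℂ ≃+* ℂ) • s ∧
      ∀ t : K i₀ →+* ℂ, t ≠ s → t ≠ (starRingAut : ℂ ≃+* ℂ) • s → σ • t = t)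
    (e₀ : F →+* K i₀) (e₁ : F →+* K i₁) (hF₀ : finrank ℚ (K i₀) = 2 * finrank ℚ F)
    (hF₁ : finrank ℚ (K i₁) = 2 * finrank ℚ F) (hA : ∀ i, IsCMTypeRealisation (Φ i) (A i) (ι i) (θ i))
    (hS : ∀ i, (A i).IsSimple) (hniso : ∀ i j, i ≠ j → ¬ AbelianVariety.IsIsogenous (A i) (A j)) :
    (∃ (N : ℕ) (π : Fin N → I) (m : ℕ) (c : complexBetti (⨁ fun j : Fin N => A (π j)).X (2 * m)),
      IsRationalClass c ∧
      IsOfHodgeType (⨁ fun j : Fin N => A (π j)).dim (⨁ fun j : Fin N => A (π j)).X (2 * m) m m c ∧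
      c ∉ divisorClassesSpan (⨁ fun j : Fin N => A (π j)).X (⨁ fun j : Fin N => A (π j)).dim m) ↔
      ¬ IsNondegenerate (Φ i₁) := by
  have hiff := isNondegenerateFamily_iff_of_pairFlip_of_ringHom_real_of_not_isIsogenous hI hflip e₀ e₁ hF₀ hF₁ hA hniso
  constructor
  · rintro ⟨N, π, m, c, hcQ, hcH, hcD⟩ hnd
    exact hcD (by
      rw [← (hiff.2 hnd).hodgeClassSpan_prod_eq_divisorClassesSpan hA π m]
      exact Submodule.subset_span ⟨hcQ, hcH⟩)
  · intro hdegn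
    exact CMAlgebra.exists_exceptional_prod_of_not_isNondegenerateFamily
      (CMAlgebra.isSeparatingFamily_of_isSimple_of_pairwise_not_isIsogenous hA hS hniso) (fun hf => hdegn (hiff.1 hf)) hA

end Geometry

end Summit.HodgeConjecture.CorCM

end
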